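import Summits.QuantumFields.YangMills.Theorems.SwapVirialDeficitSwapRingCeiling
import HarnessLib

/-!
# The tree-gauged σ-glued ring as LEADERS × CENTRED FOLLOWERS (brick J3, part a, of memo-24197-massive-mode-rung): the assembly equivalence
# (free-hands support of ⟨stmt-QuantumFields-24197⟩ `SwapVirialDeficit.SwapGluedStiffness`; companion of ✓`BlowUp.lintegral_haar_pi_eq_followerChart` /
# ✓`BlowUp.lintegral_haar_four_eq_leaderChart`)

The Fubini bookkeeping of ✓`SwapRing.ringMeasure_real_swapDeficit_le_le_box_of_box` splits a tree-gauged ring history `x = (w, r, g) ∈ X_fix` into the four LEADERS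
`C = (C₀, C₁, C₂, c)` (wrap links `w(−ê_μ, μ)` and the seam value `g 0`) and `6L⁴ − 3` FOLLOWERS, each divided by its box reference (letter `1`/`C_μ`, glued letter,
`c`), but only inside one proof and only as an inequality.  For the scaling identity (S) of the joint blow-up the split is needed as a named, measurable BIJECTION:

* `Foll L` — the follower index type: non-leader off-tree links of slice `0` ⊕ (slice links `Fin (2L−1) × Edge 3 L` ⊕ seam sites `x ≠ 0`);
* `letter C i` — the slaved value of the off-tree link `i` of slice `0` given the leaders (`C_μ` on a wrapping link of direction `μ`, else `1`);
* `assemble (C, V)` — the tree-gauge point with leaders `C` and followers `V` multiplied onto their centres: `w i = letter C i · V i` (non-leaders),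
  `w(−ê_μ, μ) = C_μ`, `r j e = glue (letter C) e · V (j, e)` (slices centred at the GLUED LETTERS, which depend on the leaders only), `g 0 = c`,
  `g x = c · V x` (`x ≠ 0`);  `disassemble` — the inverse (divide by the centres);
* ★★ `assembleEquiv : ((Fin 4 → SU2) × (Foll L → SU2)) ≃ᵐ X_fix` — both maps are measurable and mutually inverse.

The measure preservation (product Haar ↦ `μ_fix`, by left invariance of Haar along the follower fibres) and the resulting form of the sublevel volume
`μ_L{F^S_z ≤ s} = (Haar⁴ ⊗ Haar^{Foll}){(C, V) | F^S_z(fix(assemble(C, V))) ≤ s}` are part b (sequel file).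
HONEST LABEL: measurable bookkeeping on a fixed lattice (plan-level plumbing); NOT the fixed-`L` sharp law, NOT ⟨24197⟩; the Yang–Mills mass gap is NOT proved; no
summit is proved by a line.  Seat ym-line-fcl-p3 g45 (cell ym-idea-1, free hands; item of record ⟨24085⟩ aside, untouched), `--supports stmt-QuantumFields-24197`.
Definitions + theorems, 0 `sorry`, standard axioms.  References: [cite: Luscher1983, §2] (tree gauge of the femto ring); [folklore].
-/

set_option autoImplicit false

noncomputable section

open MeasureTheory
open scoped BigOperators ENNReal
open Literature.MathematicalPhysics.QuantumFieldTheory hiding SU2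
open Literature.MathematicalPhysics.QuantumLattice

namespace Summit.QuantumFields.YangMills.Theorems.SwapVirialDeficit.BlowUp

open Summit.QuantumFields.YangMills.Theorems.FemtoTransferGap
open Summit.QuantumFields.YangMills.Theorems.FemtoTransferGap.TT
open Summit.QuantumFields.YangMills.Theorems.SwapTwistDeficit.PeriodicRingFloor (leader_not_treeEdge)

variable {L : ℕ}

/-! ## §1 Index types and letters -/

variable (L) in
/-- **The follower index type** of the tree-gauged `2L`-slice ring: the off-tree links of slice `0` other than the three wrap links `(−ê_μ, μ)`, the links
`(j, e)` of the slices `1 … 2L−1`, and the seam sites `x ≠ 0` — `(2L³ + 1 − 3) + (2L−1)·3L³ + (L³ − 1) = 6L⁴ − 3` Haar letters (✓`card_nonleaders`).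
[cite: Luscher1983, §2] -/
abbrev Foll : Type :=
  {i : OffIdx L // ¬ i.1 = (Pi.single i.1.2 (-1 : ZMod L), i.1.2)} ⊕ ((Fin (2 * L - 1) × Edge 3 L) ⊕ {x : Site 3 L // x ≠ 0})

variable (L) in
/-- **The tree-gauge configuration space** `X_fix = (off-tree links of slice 0) × (slices 1…2L−1) × (seam field)` of ✓`SwapRing.measureReal_swapDeficit_le_eq_fix`.
[cite: Luscher1983, §2] -/
abbrev XFix : Type := (OffIdx L → SU2) × ((Fin (2 * L - 1) → GaugeConfig 3 L SU2) × (Site 3 L → SU2))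

/-- The leader (wrap) link of direction `μ`: the off-tree edge `(−ê_μ, μ)`. [folklore] -/
def leadIdx (μ : Fin 3) : OffIdx L := ⟨(Pi.single μ (-1 : ZMod L), μ), leader_not_treeEdge μ⟩

/-- An off-tree link satisfying the leader equation IS the leader link of its direction. [folklore] -/
theorem eq_leadIdx_of {i : OffIdx L} (h : i.1 = (Pi.single i.1.2 (-1 : ZMod L), i.1.2)) : i = leadIdx i.1.2 :=
  Subtype.ext h

/-- The leader link satisfies the leader equation. [folklore] -/
theorem leadIdx_eq (μ : Fin 3) : (leadIdx (L := L) μ).1 = (Pi.single (leadIdx (L := L) μ).1.2 (-1 : ZMod L), (leadIdx (L := L) μ).1.2) := rfl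

/-- **Letters**: the slaved value of the off-tree link `i` of slice `0` given the leaders — `C_μ` on a wrapping link of direction `μ` (`i.1.1 μ = −1`),
`1` otherwise (✓`swapCommBox_of_swapRingDeficit`'s references). [cite: Luscher1983, §2] -/
def letter (C : Fin 4 → SU2) (i : OffIdx L) : SU2 := if i.1.1 i.1.2 = -1 then C (Fin.castSucc i.1.2) else 1

/-- On the leader link of direction `μ` the letter is `C_μ`. [folklore] -/
theorem letter_leadIdx (C : Fin 4 → SU2) (μ : Fin 3) : letter C (leadIdx (L := L) μ) = C (Fin.castSucc μ) := by
  unfold letter leadIdx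
  simp

/-! ## §2 Assembly and disassembly -/

/-- **Assembly**: leaders `C` and centred followers `V` ↦ the tree-gauge point `(w, r, g)`. [cite: Luscher1983, §2] -/
def assemble (q : (Fin 4 → SU2) × (Foll L → SU2)) : XFix L :=
  (fun i => if h : i.1 = (Pi.single i.1.2 (-1 : ZMod L), i.1.2) then q.1 (Fin.castSucc i.1.2) else letter q.1 i * q.2 (Sum.inl ⟨i, h⟩),
    (fun j e => glue (letter q.1) e * q.2 (Sum.inr (Sum.inl (j, e))),
      fun x => if h : x = 0 then q.1 (Fin.last 3) else q.1 (Fin.last 3) * q.2 (Sum.inr (Sum.inr ⟨x, h⟩))))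

/-- Slice-`0` component of `assemble` on a leader link. [folklore] -/
theorem assemble_fst_of_lead (q : (Fin 4 → SU2) × (Foll L → SU2)) {i : OffIdx L} (h : i.1 = (Pi.single i.1.2 (-1 : ZMod L), i.1.2)) :
    (assemble q).1 i = q.1 (Fin.castSucc i.1.2) := by
  show (if h : i.1 = (Pi.single i.1.2 (-1 : ZMod L), i.1.2) then q.1 (Fin.castSucc i.1.2) else letter q.1 i * q.2 (Sum.inl ⟨i, h⟩)) = _
  rw [dif_pos h]

/-- Slice-`0` component of `assemble` on a follower link. [folklore] -/
theorem assemble_fst_of_not_lead (q : (Fin 4 → SU2) × (Foll L → SU2)) {i : OffIdx L} (h : ¬ i.1 = (Pi.single i.1.2 (-1 : ZMod L), i.1.2)) :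
    (assemble q).1 i = letter q.1 i * q.2 (Sum.inl ⟨i, h⟩) := by
  show (if h : i.1 = (Pi.single i.1.2 (-1 : ZMod L), i.1.2) then q.1 (Fin.castSucc i.1.2) else letter q.1 i * q.2 (Sum.inl ⟨i, h⟩)) = _
  rw [dif_neg h]

/-- Slice components of `assemble`. [folklore] -/
theorem assemble_snd_fst (q : (Fin 4 → SU2) × (Foll L → SU2)) (j : Fin (2 * L - 1)) (e : Edge 3 L) :
    (assemble q).2.1 j e = glue (letter q.1) e * q.2 (Sum.inr (Sum.inl (j, e))) := rfl

/-- Seam component of `assemble` at the origin. [folklore] -/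
theorem assemble_snd_snd_zero (q : (Fin 4 → SU2) × (Foll L → SU2)) : (assemble q).2.2 0 = q.1 (Fin.last 3) := by
  show (if h : (0 : Site 3 L) = 0 then q.1 (Fin.last 3) else q.1 (Fin.last 3) * q.2 (Sum.inr (Sum.inr ⟨0, h⟩))) = _
  rw [dif_pos rfl]

/-- Seam component of `assemble` off the origin. [folklore] -/
theorem assemble_snd_snd_of_ne (q : (Fin 4 → SU2) × (Foll L → SU2)) {x : Site 3 L} (h : x ≠ 0) :
    (assemble q).2.2 x = q.1 (Fin.last 3) * q.2 (Sum.inr (Sum.inr ⟨x, h⟩)) := by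
  show (if h : x = 0 then q.1 (Fin.last 3) else q.1 (Fin.last 3) * q.2 (Sum.inr (Sum.inr ⟨x, h⟩))) = _
  rw [dif_neg h]

/-- **The leaders of a tree-gauge point**: `(w(−ê_0,0), w(−ê_1,1), w(−ê_2,2), g 0)`. [folklore] -/
def leadersOf (x : XFix L) : Fin 4 → SU2 := Fin.snoc (fun μ : Fin 3 => x.1 (leadIdx μ)) (x.2.2 0)

/-- Components of `leadersOf`. [folklore] -/
theorem leadersOf_castSucc (x : XFix L) (μ : Fin 3) : leadersOf x (Fin.castSucc μ) = x.1 (leadIdx μ) := by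
  unfold leadersOf; exact Fin.snoc_castSucc (α := fun _ => SU2) _ _ _

/-- Components of `leadersOf`. [folklore] -/
theorem leadersOf_last (x : XFix L) : leadersOf x (Fin.last 3) = x.2.2 0 := by
  unfold leadersOf; exact Fin.snoc_last (α := fun _ => SU2) _ _

/-- The centred follower coordinate of a tree-gauge point. [folklore] -/
def follOf (x : XFix L) : Foll L → SU2 := fun f => match f with
  | Sum.inl i => (letter (leadersOf x) i.1)⁻¹ * x.1 i.1
  | Sum.inr (Sum.inl je) => (glue (letter (leadersOf x)) je.2)⁻¹ * x.2.1 je.1 je.2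
  | Sum.inr (Sum.inr y) => (x.2.2 0)⁻¹ * x.2.2 y.1

/-- Components of `follOf`. [folklore] -/
theorem follOf_inl (x : XFix L) (i : {i : OffIdx L // ¬ i.1 = (Pi.single i.1.2 (-1 : ZMod L), i.1.2)}) :
    follOf x (Sum.inl i) = (letter (leadersOf x) i.1)⁻¹ * x.1 i.1 := rfl

/-- Components of `follOf`. [folklore] -/
theorem follOf_inr_inl (x : XFix L) (je : Fin (2 * L - 1) × Edge 3 L) :
    follOf x (Sum.inr (Sum.inl je)) = (glue (letter (leadersOf x)) je.2)⁻¹ * x.2.1 je.1 je.2 := rfl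

/-- Components of `follOf`. [folklore] -/
theorem follOf_inr_inr (x : XFix L) (y : {x : Site 3 L // x ≠ 0}) :
    follOf x (Sum.inr (Sum.inr y)) = (x.2.2 0)⁻¹ * x.2.2 y.1 := rfl

/-- **Disassembly**: a tree-gauge point ↦ its leaders and its followers divided by their centres. [cite: Luscher1983, §2] -/
def disassemble (x : XFix L) : (Fin 4 → SU2) × (Foll L → SU2) := (leadersOf x, follOf x)

/-- The leaders of an assembled point are the given leaders. [folklore] -/
theorem leadersOf_assemble (q : (Fin 4 → SU2) × (Foll L → SU2)) : leadersOf (assemble q) = q.1 := by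
  funext k
  refine Fin.lastCases ?_ (fun μ => ?_) k
  · rw [leadersOf_last, assemble_snd_snd_zero]
  · rw [leadersOf_castSucc, assemble_fst_of_lead q (leadIdx_eq μ)]
    rfl

/-- `disassemble ∘ assemble = id`. [folklore] -/
theorem disassemble_assemble (q : (Fin 4 → SU2) × (Foll L → SU2)) : disassemble (assemble q) = q := by
  have hC := leadersOf_assemble q
  refine Prod.ext hC (funext fun f => ?_)
  show follOf (assemble q) f = q.2 f
  rcases f with i | je | y
  · rw [follOf_inl, hC, assemble_fst_of_not_lead q i.2, inv_mul_cancel_left]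
  · rw [follOf_inr_inl, hC, assemble_snd_fst, inv_mul_cancel_left]
  · rw [follOf_inr_inr, assemble_snd_snd_zero, assemble_snd_snd_of_ne q y.2, inv_mul_cancel_left]

/-- `assemble ∘ disassemble = id`. [folklore] -/
theorem assemble_disassemble (x : XFix L) : assemble (disassemble x) = x := by
  have h1 : (disassemble x).1 = leadersOf x := rfl
  have h2 : (disassemble x).2 = follOf x := rfl
  refine Prod.ext (funext fun i => ?_) (Prod.ext (funext fun j => funext fun e => ?_) (funext fun y => ?_))
  · by_cases h : i.1 = (Pi.single i.1.2 (-1 : ZMod L), i.1.2)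
    · rw [assemble_fst_of_lead _ h, h1, leadersOf_castSucc, ← eq_leadIdx_of h]
    · rw [assemble_fst_of_not_lead _ h, h1, h2, follOf_inl, mul_inv_cancel_left]
  · rw [assemble_snd_fst, h1, h2, follOf_inr_inl, mul_inv_cancel_left]
  · by_cases hy : y = 0
    · subst hy
      rw [assemble_snd_snd_zero, h1, leadersOf_last]
    · rw [assemble_snd_snd_of_ne _ hy, h1, h2, follOf_inr_inr, leadersOf_last, mul_inv_cancel_left]

/-! ## §3 Measurability -/

/-- `letter C i` is measurable in `C`. [folklore] -/
theorem measurable_letter (i : OffIdx L) : Measurable fun C : Fin 4 → SU2 => letter C i := by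
  unfold letter
  by_cases h : i.1.1 i.1.2 = -1
  · simp only [h, if_true]; exact measurable_pi_apply _
  · simp only [h]; exact measurable_const

/-- `glue (letter C) e` is measurable in `C`. [folklore] -/
theorem measurable_glue_letter (e : Edge 3 L) : Measurable fun C : Fin 4 → SU2 => glue (letter C) e :=
  (measurable_pi_apply e).comp (measurable_glue.comp (measurable_pi_lambda _ fun i => measurable_letter i))

/-- `assemble` is measurable. [folklore] -/
theorem measurable_assemble : Measurable (assemble (L := L)) := by
  refine Measurable.prodMk ?_ (Measurable.prodMk ?_ ?_)
  · refine measurable_pi_lambda _ fun i => ?_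
    show Measurable fun q : (Fin 4 → SU2) × (Foll L → SU2) => (assemble q).1 i
    by_cases h : i.1 = (Pi.single i.1.2 (-1 : ZMod L), i.1.2)
    · have e : (fun q : (Fin 4 → SU2) × (Foll L → SU2) => (assemble q).1 i) = fun q => q.1 (Fin.castSucc i.1.2) :=
        funext fun q => assemble_fst_of_lead q h
      rw [e]
      exact (measurable_pi_apply _).comp measurable_fst
    · have e : (fun q : (Fin 4 → SU2) × (Foll L → SU2) => (assemble q).1 i) = fun q => letter q.1 i * q.2 (Sum.inl ⟨i, h⟩) :=
        funext fun q => assemble_fst_of_not_lead q h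
      rw [e]
      exact ((measurable_letter i).comp measurable_fst).mul ((measurable_pi_apply _).comp measurable_snd)
  · refine measurable_pi_lambda _ fun j => measurable_pi_lambda _ fun e => ?_
    show Measurable fun q : (Fin 4 → SU2) × (Foll L → SU2) => glue (letter q.1) e * q.2 (Sum.inr (Sum.inl (j, e)))
    exact ((measurable_glue_letter e).comp measurable_fst).mul ((measurable_pi_apply _).comp measurable_snd)
  · refine measurable_pi_lambda _ fun y => ?_
    show Measurable fun q : (Fin 4 → SU2) × (Foll L → SU2) => (assemble q).2.2 y
    by_cases hy : y = 0
    · subst hy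
      have e : (fun q : (Fin 4 → SU2) × (Foll L → SU2) => (assemble q).2.2 0) = fun q => q.1 (Fin.last 3) :=
        funext fun q => assemble_snd_snd_zero q
      rw [e]
      exact (measurable_pi_apply _).comp measurable_fst
    · have e : (fun q : (Fin 4 → SU2) × (Foll L → SU2) => (assemble q).2.2 y) = fun q => q.1 (Fin.last 3) * q.2 (Sum.inr (Sum.inr ⟨y, hy⟩)) :=
        funext fun q => assemble_snd_snd_of_ne q hy
      rw [e]
      exact ((measurable_pi_apply _).comp measurable_fst).mul ((measurable_pi_apply _).comp measurable_snd)

/-- `leadersOf` is measurable. [folklore] -/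
theorem measurable_leadersOf : Measurable (leadersOf (L := L)) := by
  refine measurable_pi_lambda _ fun k => ?_
  refine Fin.lastCases ?_ (fun μ => ?_) k
  · have e : (fun x : XFix L => leadersOf x (Fin.last 3)) = fun x => x.2.2 0 := funext fun x => leadersOf_last x
    rw [e]
    exact (measurable_pi_apply _).comp (measurable_snd.comp measurable_snd)
  · have e : (fun x : XFix L => leadersOf x (Fin.castSucc μ)) = fun x => x.1 (leadIdx μ) := funext fun x => leadersOf_castSucc x μ
    rw [e]
    exact (measurable_pi_apply _).comp measurable_fst

/-- `follOf` is measurable. [folklore] -/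
theorem measurable_follOf : Measurable (follOf (L := L)) := by
  refine measurable_pi_lambda _ fun f => ?_
  rcases f with i | je | y
  · show Measurable fun x : XFix L => (letter (leadersOf x) i.1)⁻¹ * x.1 i.1
    exact ((measurable_letter i.1).comp measurable_leadersOf).inv.mul ((measurable_pi_apply _).comp measurable_fst)
  · show Measurable fun x : XFix L => (glue (letter (leadersOf x)) je.2)⁻¹ * x.2.1 je.1 je.2
    exact ((measurable_glue_letter je.2).comp measurable_leadersOf).inv.mul
      ((measurable_pi_apply _).comp ((measurable_pi_apply _).comp (measurable_fst.comp measurable_snd)))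
  · show Measurable fun x : XFix L => (x.2.2 0)⁻¹ * x.2.2 y.1
    exact ((measurable_pi_apply _).comp (measurable_snd.comp measurable_snd)).inv.mul
      ((measurable_pi_apply _).comp (measurable_snd.comp measurable_snd))

/-- `disassemble` is measurable. [folklore] -/
theorem measurable_disassemble : Measurable (disassemble (L := L)) := measurable_leadersOf.prodMk measurable_follOf

/-- ★★ **The assembly equivalence** `(leaders, centred followers) ≃ᵐ X_fix`. [cite: Luscher1983, §2] -/
def assembleEquiv : ((Fin 4 → SU2) × (Foll L → SU2)) ≃ᵐ XFix L where
  toFun := assemble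
  invFun := disassemble
  left_inv := disassemble_assemble
  right_inv := assemble_disassemble
  measurable_toFun := measurable_assemble
  measurable_invFun := measurable_disassemble

/-- `assembleEquiv` is `assemble`. [folklore] -/
theorem assembleEquiv_apply (q : (Fin 4 → SU2) × (Foll L → SU2)) : assembleEquiv q = assemble q := rfl

/-- `assembleEquiv.symm` is `disassemble`. [folklore] -/
theorem assembleEquiv_symm_apply (x : XFix L) : assembleEquiv.symm x = disassemble x := rfl

end Summit.QuantumFields.YangMills.Theorems.SwapVirialDeficit.BlowUp

end
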